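import Mathlib
import HarnessLib
import Literature.Computability.AlgebraicComplexity.PatternExpressions
import Summits.ValiantsHypothesis.ValiantsHypothesis.Theorems.MonotoneRestorationOrbitCompressionQPDiHomSpanTools
import Summits.ValiantsHypothesis.ValiantsHypothesis.Theorems.MonotoneRestorationOrbitRestorationQPHomSpan

/-!
# Square-symmetric polynomials are linear combinations of DIRECTED homomorphism polynomials

Route MonotoneRestoration; derived node `NonnegRestorationQP` (stmt-16191), aside `OrbitCompressionQP`
(stmt-18332), crux `OrbitRestorationQP` (stmt-18293).  Certifies (spanning direction, def-free) the
statement that Dawar–Pago–Seppelt 2025 (p. 17 Remark, p. 45) and Dwivedi–Pago–Seppelt 2026 (§1 footnote)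
record without proof and then set aside ("in order not to deal with loops and directed edges, we focus on
matrix symmetries"): **a polynomial on the `n × n` matrix invariant under the DIAGONAL action of `Sym_n`
(square-symmetric) is a `ℂ`-combination of directed looped homomorphism polynomials**
`dihom_{E,n} = Σ_{h : V → [n]} Π_{(u,v) ∈ E} x_{h u, h v}` of directed multigraph patterns
`E : Multiset (Fin a × Fin a)` with `a ≤ min(2·deg p, n)` vertices and `≤ deg p` edges
(`mem_span_diHom_of_squareSymmetric`).  The proof is the one-sorted version of
`HomSpan.mem_span_homPoly_of_matrixSymmetric` (Reynolds over `Sym_n`, the directed pattern of a monomial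
exponent, induction on the number of indices used).

Why the route needs the one-sorted currency: its circuits are SQUARE-symmetric (Dawar–Wilsenach `ORB`),
and the first half of the compression line of `OrbitCompressionQP` ("qp-orbit square-symmetric circuits ⇒
narrow expressions") can only be true with DIRECTED patterns/expressions unless matrix symmetry of the
output is added and an extra one-sorted→two-sorted passage is proved
(`Theorems/…OrbitToNarrowExpressionFalse.lean`).  Honest label: literature-grade algebra; no stub closed;
VP ≠ VNP not moved.
[cite: DawarPagoSeppelt2025, Remark p. 17 and §8 p. 45] [cite: DwivediPagoSeppelt2026, §1 (footnote)]
-/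

noncomputable section

open MvPolynomial

-- `Summit.ValiantsHypothesis.ValiantsHypothesis.…` is the tree's single-conjunct layout (Sub = Summit).
set_option linter.dupNamespace false

namespace Summit.ValiantsHypothesis.ValiantsHypothesis.Theorems

namespace DiHomSpan

open Literature.Computability.AlgebraicComplexity

variable {n : ℕ}

/-! ### The directed pattern of a monomial exponent -/

/-- **The directed pattern of a monomial exponent**: vertices = indices used (as a row or a column),
edges = cells with multiplicity; no isolated vertices; `D` is its injective push-forward along the
inclusion. [folklore] -/
theorem exists_dipresentation (D : (Fin n × Fin n) →₀ ℕ) :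
    ∃ (V : Type) (_ : Fintype V) (_ : DecidableEq V) (E : Multiset (V × V)) (h₀ : V → Fin n),
      (∀ v, ∃ e ∈ E, e.1 = v ∨ e.2 = v) ∧ Function.Injective h₀ ∧
      Multiset.toFinsupp (E.map fun e => (h₀ e.1, h₀ e.2)) = D ∧
      Fintype.card V = (D.support.image Prod.fst ∪ D.support.image Prod.snd).card ∧
      Multiset.card E = Multiset.card (Finsupp.toMultiset D) := by
  classical
  have hfst : ∀ x : {ij // ij ∈ Finsupp.toMultiset D},
      x.1.1 ∈ D.support.image Prod.fst ∪ D.support.image Prod.snd := fun x =>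
    Finset.mem_union_left _ (Finset.mem_image_of_mem _ (Finsupp.mem_toMultiset _ _ |>.1 x.2))
  have hsnd : ∀ x : {ij // ij ∈ Finsupp.toMultiset D},
      x.1.2 ∈ D.support.image Prod.fst ∪ D.support.image Prod.snd := fun x =>
    Finset.mem_union_right _ (Finset.mem_image_of_mem _ (Finsupp.mem_toMultiset _ _ |>.1 x.2))
  let E : Multiset ((D.support.image Prod.fst ∪ D.support.image Prod.snd : Finset (Fin n)) ×
      (D.support.image Prod.fst ∪ D.support.image Prod.snd : Finset (Fin n))) :=
    (Finsupp.toMultiset D).attach.map fun x => (⟨x.1.1, hfst x⟩, ⟨x.1.2, hsnd x⟩)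
  refine ⟨(D.support.image Prod.fst ∪ D.support.image Prod.snd : Finset (Fin n)), inferInstance,
    inferInstance, E, Subtype.val, ?_, Subtype.val_injective, ?_, Fintype.card_coe _, by simp [E]⟩
  · rintro ⟨i, hi⟩
    rcases Finset.mem_union.1 hi with hi' | hi'
    · obtain ⟨ij, hij, rfl⟩ := Finset.mem_image.1 hi'
      exact ⟨(⟨ij.1, hfst ⟨ij, (Finsupp.mem_toMultiset _ _).2 hij⟩⟩,
          ⟨ij.2, hsnd ⟨ij, (Finsupp.mem_toMultiset _ _).2 hij⟩⟩),
        Multiset.mem_map.2 ⟨⟨ij, (Finsupp.mem_toMultiset _ _).2 hij⟩, Multiset.mem_attach _ _, rfl⟩,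
        Or.inl rfl⟩
    · obtain ⟨ij, hij, rfl⟩ := Finset.mem_image.1 hi'
      exact ⟨(⟨ij.1, hfst ⟨ij, (Finsupp.mem_toMultiset _ _).2 hij⟩⟩,
          ⟨ij.2, hsnd ⟨ij, (Finsupp.mem_toMultiset _ _).2 hij⟩⟩),
        Multiset.mem_map.2 ⟨⟨ij, (Finsupp.mem_toMultiset _ _).2 hij⟩, Multiset.mem_attach _ _, rfl⟩,
        Or.inr rfl⟩
  · have : E.map (fun e => ((e.1 : Fin n), (e.2 : Fin n))) = Finsupp.toMultiset D := by
      simp only [E, Multiset.map_map, Function.comp_def, Prod.mk.eta, Multiset.attach_map_val]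
    rw [this, Finsupp.toMultiset_toFinsupp]

/-- The number of indices used is at most twice the degree. [folklore] -/
theorem card_union_le_two_mul_card (D : (Fin n × Fin n) →₀ ℕ) :
    (D.support.image Prod.fst ∪ D.support.image Prod.snd).card ≤
      2 * Multiset.card (Finsupp.toMultiset D) :=
  (Finset.card_union_le _ _).trans (by
    have h1 := HomSpan.card_image_fst_le_card D
    have h2 := HomSpan.card_image_snd_le_card D
    omega)

/-- Transport of a written-out directed homomorphism polynomial along a relabelling of the vertices.
[folklore] -/
theorem diHom_map_equiv {V W : Type} [Fintype V] [DecidableEq V] [Fintype W] [DecidableEq W]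
    (E : Multiset (V × V)) (eV : V ≃ W) (n : ℕ) :
    (∑ h : W → Fin n, ((E.map fun e => (eV e.1, eV e.2)).map
        fun e => (X (h e.1, h e.2) : MvPolynomial (Fin n × Fin n) ℂ)).prod) =
      ∑ h : V → Fin n, (E.map fun e => (X (h e.1, h e.2) : MvPolynomial (Fin n × Fin n) ℂ)).prod := by
  simp only [Multiset.map_map, Function.comp_def]
  exact Fintype.sum_equiv (eV.arrowCongr (Equiv.refl (Fin n))).symm _ _ fun h => by
    simp [Equiv.arrowCongr]

/-- Transport to `Fin a × Fin a` keeping the bookkeeping. [folklore] -/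
theorem diHom_mem_diHomSet {V : Type} [Fintype V] [DecidableEq V] (E : Multiset (V × V)) (n d : ℕ)
    (hV : Fintype.card V ≤ 2 * d) (hVn : Fintype.card V ≤ n) (hE : Multiset.card E ≤ d)
    (hiso : ∀ v, ∃ e ∈ E, e.1 = v ∨ e.2 = v) :
    (∑ h : V → Fin n, (E.map fun e => (X (h e.1, h e.2) : MvPolynomial (Fin n × Fin n) ℂ)).prod) ∈
      {q : MvPolynomial (Fin n × Fin n) ℂ | ∃ (a : ℕ) (E' : Multiset (Fin a × Fin a)),
        a ≤ 2 * d ∧ a ≤ n ∧ Multiset.card E' ≤ d ∧ (∀ v : Fin a, ∃ e ∈ E', e.1 = v ∨ e.2 = v) ∧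
        q = ∑ h : Fin a → Fin n,
          (E'.map fun e => (X (h e.1, h e.2) : MvPolynomial (Fin n × Fin n) ℂ)).prod} := by
  refine ⟨Fintype.card V, E.map fun e => (Fintype.equivFin V e.1, Fintype.equivFin V e.2), hV, hVn,
    by simpa using hE, fun v => ?_, (diHom_map_equiv E (Fintype.equivFin V) n).symm⟩
  obtain ⟨e, he, hev | hev⟩ := hiso ((Fintype.equivFin V).symm v)
  · exact ⟨_, Multiset.mem_map_of_mem _ he, Or.inl (by simp [hev])⟩
  · exact ⟨_, Multiset.mem_map_of_mem _ he, Or.inr (by simp [hev])⟩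

/-! ### Diagonal orbit sums are combinations of directed homomorphism polynomials -/

/-- **Diagonal orbit sums of monomial exponents lie in the span of directed homomorphism polynomials**
(strong induction on the number of indices used). [folklore] -/
theorem diOrbitSum_mem_span (d : ℕ) :
    ∀ (ν : ℕ) (D : (Fin n × Fin n) →₀ ℕ),
      (D.support.image Prod.fst ∪ D.support.image Prod.snd).card = ν →
      Multiset.card (Finsupp.toMultiset D) ≤ d →
      (∑ σ : Equiv.Perm (Fin n),
          monomial (D.mapDomain fun ij : Fin n × Fin n => (σ ij.1, σ ij.2)) (1 : ℂ)) ∈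
        Submodule.span ℂ {q : MvPolynomial (Fin n × Fin n) ℂ | ∃ (a : ℕ) (E : Multiset (Fin a × Fin a)),
          a ≤ 2 * d ∧ a ≤ n ∧ Multiset.card E ≤ d ∧ (∀ v : Fin a, ∃ e ∈ E, e.1 = v ∨ e.2 = v) ∧
          q = ∑ h : Fin a → Fin n,
            (E.map fun e => (X (h e.1, h e.2) : MvPolynomial (Fin n × Fin n) ℂ)).prod} := by
  classical
  intro ν
  induction ν using Nat.strong_induction_on with
  | _ ν ih =>
  intro D hν hd
  obtain ⟨V, iV, dV, E, h₀, hEV, h₁, hD, hcV, hcE⟩ := exists_dipresentation D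
  set I : Finset (V → Fin n) := Finset.univ.filter fun h => Function.Injective h with hI
  have h₀I : h₀ ∈ I := Finset.mem_filter.2 ⟨Finset.mem_univ _, h₁⟩
  have hR := card_smul_diHom_eq_sum_diOrbitSum E n
  conv at hR =>
    rhs
    rw [← Finset.sum_filter_add_sum_filter_not Finset.univ
      (fun h : V → Fin n => Function.Injective h)]
  have hinj : ∑ h ∈ I, ∑ σ : Equiv.Perm (Fin n),
      monomial ((Multiset.toFinsupp (E.map fun e => (h e.1, h e.2))).mapDomain
        fun ij : Fin n × Fin n => (σ ij.1, σ ij.2)) (1 : ℂ) =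
      (I.card : ℂ) • ∑ σ : Equiv.Perm (Fin n),
        monomial (D.mapDomain fun ij : Fin n × Fin n => (σ ij.1, σ ij.2)) (1 : ℂ) := by
    rw [Finset.sum_congr rfl fun h hh => ?_, Finset.sum_const, ← Nat.cast_smul_eq_nsmul ℂ]
    obtain ⟨-, hh1⟩ := Finset.mem_filter.1 hh
    rw [diOrbitSum_push_eq_of_injective E h₀ h h₁ hh1, hD]
  have hnon : ∀ h ∈ Finset.univ.filter (fun h : V → Fin n => ¬ Function.Injective h),
      (∑ σ : Equiv.Perm (Fin n),
        monomial ((Multiset.toFinsupp (E.map fun e => (h e.1, h e.2))).mapDomain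
          fun ij : Fin n × Fin n => (σ ij.1, σ ij.2)) (1 : ℂ)) ∈
        Submodule.span ℂ {q : MvPolynomial (Fin n × Fin n) ℂ | ∃ (a : ℕ) (E : Multiset (Fin a × Fin a)),
          a ≤ 2 * d ∧ a ≤ n ∧ Multiset.card E ≤ d ∧ (∀ v : Fin a, ∃ e ∈ E, e.1 = v ∨ e.2 = v) ∧
          q = ∑ h : Fin a → Fin n,
            (E.map fun e => (X (h e.1, h e.2) : MvPolynomial (Fin n × Fin n) ℂ)).prod} := by
    intro h hh
    obtain ⟨-, hh⟩ := Finset.mem_filter.1 hh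
    refine ih _ ?_ _ rfl (by rw [card_toMultiset_dipush, hcE]; exact hd)
    rw [← hν, support_dipush_image E hEV, ← hcV]
    have le1 : (Finset.univ.image h).card ≤ Fintype.card V := Finset.card_image_le.trans (by simp)
    refine lt_of_le_of_ne le1 fun heq => hh ?_
    have := Finset.injOn_of_card_image_eq (s := Finset.univ) (f := h)
      (by rw [Finset.card_univ]; exact heq)
    simpa [Set.injOn_univ] using this
  have hhom : (∑ h : V → Fin n, (E.map fun e => (X (h e.1, h e.2) : MvPolynomial (Fin n × Fin n) ℂ)).prod) ∈
      Submodule.span ℂ {q : MvPolynomial (Fin n × Fin n) ℂ | ∃ (a : ℕ) (E : Multiset (Fin a × Fin a)),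
        a ≤ 2 * d ∧ a ≤ n ∧ Multiset.card E ≤ d ∧ (∀ v : Fin a, ∃ e ∈ E, e.1 = v ∨ e.2 = v) ∧
        q = ∑ h : Fin a → Fin n,
          (E.map fun e => (X (h e.1, h e.2) : MvPolynomial (Fin n × Fin n) ℂ)).prod} := by
    refine Submodule.subset_span (diHom_mem_diHomSet E n d ?_ ?_ (hcE ▸ hd) hEV)
    · rw [hcV]; exact (card_union_le_two_mul_card D).trans (by omega)
    · rw [hcV]; exact (Finset.card_le_univ _).trans (by simp)
  have hIne : (I.card : ℂ) ≠ 0 := Nat.cast_ne_zero.2 (Finset.card_ne_zero.2 ⟨h₀, h₀I⟩)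
  rw [hinj] at hR
  have hsolve : (∑ σ : Equiv.Perm (Fin n),
      monomial (D.mapDomain fun ij : Fin n × Fin n => (σ ij.1, σ ij.2)) (1 : ℂ)) =
      (I.card : ℂ)⁻¹ • ((Fintype.card (Equiv.Perm (Fin n)) : ℂ) •
        (∑ h : V → Fin n, (E.map fun e => (X (h e.1, h e.2) : MvPolynomial (Fin n × Fin n) ℂ)).prod) -
        ∑ h ∈ Finset.univ.filter (fun h : V → Fin n => ¬ Function.Injective h),
          ∑ σ : Equiv.Perm (Fin n),
            monomial ((Multiset.toFinsupp (E.map fun e => (h e.1, h e.2))).mapDomain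
              fun ij : Fin n × Fin n => (σ ij.1, σ ij.2)) (1 : ℂ)) := by
    rw [hR, add_sub_cancel_right, smul_smul, inv_mul_cancel₀ hIne, one_smul]
  rw [hsolve]
  exact Submodule.smul_mem _ _ (Submodule.sub_mem _ (Submodule.smul_mem _ _ hhom)
    (Submodule.sum_mem _ hnon))

/-! ### The theorem -/

/-- **Square-symmetric polynomials are linear combinations of directed homomorphism polynomials.**  Every
polynomial on the `n × n` matrix invariant under the diagonal action `x_ij ↦ x_{σ i, σ j}` of `Sym_n` lies
in the `ℂ`-span of the directed looped homomorphism polynomials `Σ_{h : Fin a → Fin n} Π_{(u,v) ∈ E}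
x_{h u, h v}` of directed multigraph patterns `E : Multiset (Fin a × Fin a)` with `a ≤ min(2·deg p, n)`
vertices, `≤ deg p` edges and no isolated vertices.
[cite: DawarPagoSeppelt2025, Remark p. 17] [cite: DwivediPagoSeppelt2026, §1 (footnote)] -/
theorem mem_span_diHom_of_squareSymmetric (p : MvPolynomial (Fin n × Fin n) ℂ)
    (hp : ∀ σ : Equiv.Perm (Fin n), rename (fun ij : Fin n × Fin n => (σ ij.1, σ ij.2)) p = p) :
    p ∈ Submodule.span ℂ {q : MvPolynomial (Fin n × Fin n) ℂ | ∃ (a : ℕ) (E : Multiset (Fin a × Fin a)),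
      a ≤ 2 * p.totalDegree ∧ a ≤ n ∧ Multiset.card E ≤ p.totalDegree ∧
      (∀ v : Fin a, ∃ e ∈ E, e.1 = v ∨ e.2 = v) ∧
      q = ∑ h : Fin a → Fin n,
        (E.map fun e => (X (h e.1, h e.2) : MvPolynomial (Fin n × Fin n) ℂ)).prod} := by
  classical
  have hG : (Fintype.card (Equiv.Perm (Fin n)) : ℂ) ≠ 0 := Nat.cast_ne_zero.2 Fintype.card_ne_zero
  have key := card_smul_eq_sum_diOrbitSum p hp
  have hmem : (Fintype.card (Equiv.Perm (Fin n)) : ℂ) • p ∈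
      Submodule.span ℂ {q : MvPolynomial (Fin n × Fin n) ℂ | ∃ (a : ℕ) (E : Multiset (Fin a × Fin a)),
        a ≤ 2 * p.totalDegree ∧ a ≤ n ∧ Multiset.card E ≤ p.totalDegree ∧
        (∀ v : Fin a, ∃ e ∈ E, e.1 = v ∨ e.2 = v) ∧
        q = ∑ h : Fin a → Fin n,
          (E.map fun e => (X (h e.1, h e.2) : MvPolynomial (Fin n × Fin n) ℂ)).prod} := by
    rw [key]
    refine Submodule.sum_mem _ fun D hD => Submodule.smul_mem _ _
      (diOrbitSum_mem_span p.totalDegree _ D rfl ?_)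
    rw [Finsupp.card_toMultiset]
    exact le_totalDegree hD
  have := Submodule.smul_mem _ ((Fintype.card (Equiv.Perm (Fin n)) : ℂ)⁻¹) hmem
  rwa [smul_smul, inv_mul_cancel₀ hG, one_smul] at this

/-- In particular the square-symmetric span STRICTLY contains the matrix-symmetric one: the trace
`Σ_i x_ii` (the witness of `Theorems/…OrbitToNarrowExpressionFalse.lean`) is the directed homomorphism
polynomial of the single loop. [folklore] -/
theorem trace_eq_diHom_loop (n : ℕ) :
    (∑ i : Fin n, (X (i, i) : MvPolynomial (Fin n × Fin n) ℂ)) =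
      ∑ h : Fin 1 → Fin n, ((({((0 : Fin 1), (0 : Fin 1))} : Multiset (Fin 1 × Fin 1)).map
        fun e => (X (h e.1, h e.2) : MvPolynomial (Fin n × Fin n) ℂ)).prod) := by
  simp only [Multiset.map_singleton, Multiset.prod_singleton]
  exact (Fintype.sum_equiv (Equiv.funUnique (Fin 1) (Fin n)) _ _ fun h => rfl).symm

end DiHomSpan

end Summit.ValiantsHypothesis.ValiantsHypothesis.Theorems

end
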